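import Literature.MathematicalPhysics.QuantumLattice.TraceInequalitiesProofs

/-!
# Route BalabanIR — crux 4 `BirGappedPhaseReduction` (item `stmt-HubbardSuperconductivity-2082`): the trace Hölder step of the coercivity dictionary

The reduction `BirGappedPhaseReduction` (engine → target) must deliver the induced phase action
INSIDE a coercive class: the modulus of the fermionic weight of a space-time phase configuration
`θ = (θ_τ)_{τ < M}` has to be bounded by `exp(-a c₀ Σ_τ R(θ_τ))` relative to the aligned one.
The route obtains this from the static phase rigidity of crux 3 (`BirBdGPhaseCoercivity`, a bound
on `Σ_i |λ_i(Hb(θ))|` slice by slice) through the TRACE HÖLDER INEQUALITY quoted in the route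
file (docstring of `BirBdGPhaseCoercivity`, ROLE): for Hermitian `H_τ` and `a ≥ 0`,

  `|Tr ∏_{τ<M} e^{-a H_τ}| ≤ ∏_{τ<M} (Tr e^{-M a H_τ})^{1/M}`,

the case `p_τ = M` of Hölder's inequality for Schatten norms `|Tr(A₁⋯A_M)| ≤ ∏ ‖A_τ‖_M`
(Simon, *Trace ideals*, Thm. 2.8; Bhatia, *Matrix Analysis*, Ex. IV.2.7). This file proves it for
a DYADIC number of factors `M = 2^{k+1}` — which is all the reduction needs, since the Trotter
number `M = β/a` may be taken along powers of two (`β → ∞` along any sequence suffices for the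
zero-temperature step `tendsto_sectorGibbs_atTop` of `…SectorGibbs.lean`) — by an elementary
induction on `k` from the Schwarz inequality `norm_trace_mul_le` and Petz's companion bound
`norm_trace_mul_pow_two_pow_le` of `Literature/…/TraceInequalities.lean` (pair consecutive
factors; the pair step `‖AB‖_{2^k}² ≤ ‖A‖_{2^{k+1}} ‖B‖_{2^{k+1}}` is cyclicity plus that bound):

* `norm_trace_list_prod_pow_le` — for any list of `2^{k+1}` square matrices over `ℝ` or `ℂ`,
  `‖Tr(A₁ ⋯ A_{2^{k+1}})‖^{2^{k+1}} ≤ ∏_i Re Tr (A_iᴴ A_i)^{2^k}` (`= ∏ ‖A_i‖_{2^{k+1}}^{2^{k+1}}`);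
  `norm_trace_ofFn_prod_pow_le` — the same for `Fin (2^{k+1})`-indexed families;
* `norm_trace_ofFn_prod_pow_le_of_posSemidef` — positive factors: `≤ ∏_i Re Tr A_i^{2^{k+1}}`;
* `norm_trace_prod_exp_pow_le` — Hermitian `G_i`: `‖Tr ∏ e^{G_i}‖^{M} ≤ ∏ Re Tr e^{M • G_i}`,
  and the thermal form `norm_trace_prod_exp_neg_smul_le` :
  `‖Tr ∏_τ e^{-a H_τ}‖ ≤ ∏_τ (Re Tr e^{-(M a) H_τ})^{1/M}`, `M = 2^{k+1}`.

Sources: B. Simon, *Trace Ideals and Their Applications*, 2nd ed. (2005), Thm. 2.8;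
R. Bhatia, *Matrix Analysis* (1997), §IV.2; D. Petz, Banach Center Publ. 30 (1994) 287, proof of
Thm. 5 (the dyadic iteration). No definition is introduced.
-/

noncomputable section

open scoped ComplexOrder MatrixOrder

namespace Summit.HubbardSuperconductivity.HubbardSuperconductivity.Theorems

open Matrix NormedSpace Literature.MathematicalPhysics.QuantumLattice

variable {𝕜 : Type*} [RCLike 𝕜] {n : Type*} [Fintype n] [DecidableEq n]

/-! ### List bookkeeping: pairing consecutive factors -/

/-- A list of length `2m` is the concatenation of `m` consecutive pairs. [folklore] -/
theorem exists_pairs_of_length_eq_two_mul {α : Type*} (m : ℕ) :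
    ∀ l : List α, l.length = 2 * m →
      ∃ p : List (α × α), p.length = m ∧ l = (p.map fun x => [x.1, x.2]).flatten := by
  induction m with
  | zero =>
    intro l hl
    refine ⟨[], rfl, ?_⟩
    simpa using hl
  | succ m ih =>
    intro l hl
    match l, hl with
    | a :: b :: t, hl =>
      have ht : t.length = 2 * m := by
        simp only [List.length_cons] at hl
        omega
      obtain ⟨p, hp, rfl⟩ := ih t ht
      exact ⟨(a, b) :: p, by simp [hp], by simp⟩
    | [], hl => simp at hl
    | [a], hl => simp at hl; omega

/-- The product of a concatenation of pairs is the product of the pair products. [folklore] -/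
theorem prod_flatten_pairs {α : Type*} [Monoid α] (p : List (α × α)) :
    ((p.map fun x => [x.1, x.2]).flatten).prod = (p.map fun x => x.1 * x.2).prod := by
  induction p with
  | nil => simp
  | cons x p ih =>
    simp only [List.map_cons, List.flatten_cons, List.prod_append, List.prod_cons, List.prod_nil,
      mul_one, ih, mul_assoc]

/-- Pairwise comparison of nonnegative real list products: if `0 ≤ f(ab)` and
`f(ab)² ≤ g a · g b` with `g ≥ 0`, then `(∏ f(a_j b_j))² ≤ ∏_j g a_j · g b_j`. [folklore] -/
theorem prod_map_sq_le_prod_flatten_map {α : Type*} [Monoid α] (f g : α → ℝ)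
    (hf : ∀ a b, 0 ≤ f (a * b)) (hg : ∀ a, 0 ≤ g a)
    (hfg : ∀ a b, f (a * b) ^ 2 ≤ g a * g b) (p : List (α × α)) :
    (p.map fun x => f (x.1 * x.2)).prod ^ 2 ≤ (((p.map fun x => [x.1, x.2]).flatten).map g).prod := by
  induction p with
  | nil => simp
  | cons x p ih =>
    have h0 : 0 ≤ (p.map fun x => f (x.1 * x.2)).prod :=
      List.prod_nonneg (by
        intro y hy
        obtain ⟨z, -, rfl⟩ := List.mem_map.1 hy
        exact hf _ _)
    simp only [List.map_cons, List.flatten_cons, List.map_append, List.prod_append,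
      List.prod_cons, List.prod_nil, mul_one, List.map_nil]
    rw [mul_pow]
    exact mul_le_mul (hfg x.1 x.2) ih (sq_nonneg _) (mul_nonneg (hg _) (hg _))

/-! ### The pair step and the dyadic trace Hölder inequality -/

/-- Traces of powers of `XᴴX`-type positive matrices are real and nonnegative:
`0 ≤ Re Tr (Aᴴ A)^m`. [folklore] -/
theorem re_trace_conjTranspose_mul_self_pow_nonneg (A : Matrix n n 𝕜) (m : ℕ) :
    0 ≤ RCLike.re ((Aᴴ * A) ^ m).trace :=
  re_trace_nonneg_of_posSemidef ((posSemidef_conjTranspose_mul_self A).pow m)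

/-- **The pair step** `‖A B‖_{2^{k+1}}^{2^{k+1}}` squared against `‖A‖_{2^{k+2}}, ‖B‖_{2^{k+2}}`:
`(Re Tr ((AB)ᴴ(AB))^{2^k})² ≤ Re Tr (AᴴA)^{2^{k+1}} · Re Tr (BᴴB)^{2^{k+1}}`. By cyclicity
`Tr ((AB)ᴴ AB)^m = Tr (AᴴA · BBᴴ)^m` and Petz's companion bound
`|Tr (M N)^{2^k}| ≤ (Tr M^{2^{k+1}})^{1/2} (Tr N^{2^{k+1}})^{1/2}` for the positive matrices
`M = AᴴA`, `N = BBᴴ`. Petz, Banach Center Publ. 30 (1994) 287, proof of Theorem 5.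
[cite: Petz1994, proof of Theorem 5] -/
theorem re_trace_conjTranspose_mul_self_pow_sq_le (A B : Matrix n n 𝕜) (k : ℕ) :
    RCLike.re ((((A * B)ᴴ * (A * B)) ^ 2 ^ k).trace) ^ 2 ≤
      RCLike.re ((Aᴴ * A) ^ 2 ^ (k + 1)).trace * RCLike.re ((Bᴴ * B) ^ 2 ^ (k + 1)).trace := by
  have hA := posSemidef_conjTranspose_mul_self A
  have hB := posSemidef_self_mul_conjTranspose B
  have hcyc : (((A * B)ᴴ * (A * B)) ^ 2 ^ k).trace = ((Aᴴ * A * (B * Bᴴ)) ^ 2 ^ k).trace := by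
    rw [conjTranspose_mul, show Bᴴ * Aᴴ * (A * B) = Bᴴ * (Aᴴ * A * B) by
      simp only [Matrix.mul_assoc], trace_mul_pow_comm]
    simp only [Matrix.mul_assoc]
  have h0 : 0 ≤ RCLike.re ((((A * B)ᴴ * (A * B)) ^ 2 ^ k).trace) :=
    re_trace_conjTranspose_mul_self_pow_nonneg _ _
  have h1 : RCLike.re ((((A * B)ᴴ * (A * B)) ^ 2 ^ k).trace) ≤
      √(RCLike.re ((Aᴴ * A) ^ 2 ^ (k + 1)).trace) * √(RCLike.re ((Bᴴ * B) ^ 2 ^ (k + 1)).trace) := by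
    calc RCLike.re ((((A * B)ᴴ * (A * B)) ^ 2 ^ k).trace)
        = RCLike.re (((Aᴴ * A * (B * Bᴴ)) ^ 2 ^ k).trace) := by rw [hcyc]
      _ ≤ ‖((Aᴴ * A * (B * Bᴴ)) ^ 2 ^ k).trace‖ := RCLike.re_le_norm _
      _ ≤ √(RCLike.re ((Aᴴ * A) ^ 2 ^ (k + 1)).trace) *
            √(RCLike.re ((B * Bᴴ) ^ 2 ^ (k + 1)).trace) := norm_trace_mul_pow_two_pow_le hA hB k
      _ = √(RCLike.re ((Aᴴ * A) ^ 2 ^ (k + 1)).trace) *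
            √(RCLike.re ((Bᴴ * B) ^ 2 ^ (k + 1)).trace) := by rw [trace_mul_pow_comm B Bᴴ]
  have hA0 : 0 ≤ RCLike.re ((Aᴴ * A) ^ 2 ^ (k + 1)).trace :=
    re_trace_conjTranspose_mul_self_pow_nonneg _ _
  have hB0 : 0 ≤ RCLike.re ((Bᴴ * B) ^ 2 ^ (k + 1)).trace :=
    re_trace_conjTranspose_mul_self_pow_nonneg _ _
  calc RCLike.re ((((A * B)ᴴ * (A * B)) ^ 2 ^ k).trace) ^ 2
      ≤ (√(RCLike.re ((Aᴴ * A) ^ 2 ^ (k + 1)).trace) *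
          √(RCLike.re ((Bᴴ * B) ^ 2 ^ (k + 1)).trace)) ^ 2 :=
        pow_le_pow_left₀ h0 h1 2
    _ = RCLike.re ((Aᴴ * A) ^ 2 ^ (k + 1)).trace * RCLike.re ((Bᴴ * B) ^ 2 ^ (k + 1)).trace := by
        rw [mul_pow, Real.sq_sqrt hA0, Real.sq_sqrt hB0]

/-- **Dyadic trace Hölder inequality** (Hölder's inequality for Schatten norms with all exponents
equal to the number of factors, `M = 2^{k+1}`): for any `2^{k+1}` square matrices over `ℝ` or `ℂ`,
`‖Tr(A₁ A₂ ⋯ A_M)‖^M ≤ ∏_i Re Tr (A_iᴴ A_i)^{M/2} = ∏_i ‖A_i‖_M^M`. Induction on `k`: the case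
`k = 0` is the Schwarz inequality `norm_trace_mul_le`; the step pairs consecutive factors and uses
`re_trace_conjTranspose_mul_self_pow_sq_le`. Simon, *Trace Ideals* (2005), Thm. 2.8 (general
Hölder); this dyadic case after Petz, Banach Center Publ. 30 (1994) 287, proof of Thm. 5.
[cite: Simon2005TraceIdeals, Theorem 2.8] -/
theorem norm_trace_list_prod_pow_le (k : ℕ) :
    ∀ l : List (Matrix n n 𝕜), l.length = 2 ^ (k + 1) →
      ‖l.prod.trace‖ ^ 2 ^ (k + 1) ≤
        (l.map fun X => RCLike.re ((Xᴴ * X) ^ 2 ^ k).trace).prod := by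
  induction k with
  | zero =>
    intro l hl
    obtain ⟨A, B, rfl⟩ := List.length_eq_two.1 (by simpa using hl)
    have h := norm_trace_mul_le A B
    have hA0 : 0 ≤ RCLike.re (Aᴴ * A).trace := by
      simpa using re_trace_conjTranspose_mul_self_pow_nonneg A 1
    have hB0 : 0 ≤ RCLike.re (Bᴴ * B).trace := by
      simpa using re_trace_conjTranspose_mul_self_pow_nonneg B 1
    have h2 : ‖(A * B).trace‖ ^ 2 ≤ RCLike.re (Aᴴ * A).trace * RCLike.re (Bᴴ * B).trace := by
      calc ‖(A * B).trace‖ ^ 2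
          ≤ (√(RCLike.re (Aᴴ * A).trace) * √(RCLike.re (Bᴴ * B).trace)) ^ 2 :=
            pow_le_pow_left₀ (norm_nonneg _) h 2
        _ = RCLike.re (Aᴴ * A).trace * RCLike.re (Bᴴ * B).trace := by
            rw [mul_pow, Real.sq_sqrt hA0, Real.sq_sqrt hB0]
    simpa using h2
  | succ k ih =>
    intro l hl
    obtain ⟨p, hp, rfl⟩ := exists_pairs_of_length_eq_two_mul (2 ^ (k + 1)) l
      (by rw [hl, pow_succ, mul_comm])
    have hlen : (p.map fun x => x.1 * x.2).length = 2 ^ (k + 1) := by simp [hp]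
    have h1 := ih _ hlen
    rw [← prod_flatten_pairs] at h1
    have h0 : 0 ≤ ‖((p.map fun x : Matrix n n 𝕜 × Matrix n n 𝕜 => [x.1, x.2]).flatten).prod.trace‖ ^
        2 ^ (k + 1) :=
      pow_nonneg (norm_nonneg _) _
    calc ‖((p.map fun x : Matrix n n 𝕜 × Matrix n n 𝕜 => [x.1, x.2]).flatten).prod.trace‖ ^
          2 ^ (k + 1 + 1)
        = (‖((p.map fun x : Matrix n n 𝕜 × Matrix n n 𝕜 => [x.1, x.2]).flatten).prod.trace‖ ^
            2 ^ (k + 1)) ^ 2 := by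
          rw [← pow_mul, ← pow_succ]
      _ ≤ ((p.map fun x => x.1 * x.2).map fun X => RCLike.re ((Xᴴ * X) ^ 2 ^ k).trace).prod ^ 2 :=
          pow_le_pow_left₀ h0 h1 2
      _ = (p.map fun x : Matrix n n 𝕜 × Matrix n n 𝕜 =>
            RCLike.re (((x.1 * x.2)ᴴ * (x.1 * x.2)) ^ 2 ^ k).trace).prod ^ 2 := by
          rw [List.map_map]; rfl
      _ ≤ (((p.map fun x => [x.1, x.2]).flatten).map
            fun X => RCLike.re ((Xᴴ * X) ^ 2 ^ (k + 1)).trace).prod :=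
          prod_map_sq_le_prod_flatten_map (fun X => RCLike.re ((Xᴴ * X) ^ 2 ^ k).trace)
            (fun X => RCLike.re ((Xᴴ * X) ^ 2 ^ (k + 1)).trace)
            (fun A B => re_trace_conjTranspose_mul_self_pow_nonneg _ _)
            (fun A => re_trace_conjTranspose_mul_self_pow_nonneg _ _)
            (fun A B => re_trace_conjTranspose_mul_self_pow_sq_le A B k) p

/-- **Dyadic trace Hölder inequality, indexed form**: for a family `A : Fin (2^{k+1}) → Mat_n`,
`‖Tr(A₀ A₁ ⋯)‖^{2^{k+1}} ≤ ∏_i Re Tr (A_iᴴ A_i)^{2^k}`. Simon, *Trace Ideals* (2005), Thm. 2.8.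
[cite: Simon2005TraceIdeals, Theorem 2.8] -/
theorem norm_trace_ofFn_prod_pow_le (k : ℕ) (A : Fin (2 ^ (k + 1)) → Matrix n n 𝕜) :
    ‖(List.ofFn A).prod.trace‖ ^ 2 ^ (k + 1) ≤ ∏ i, RCLike.re (((A i)ᴴ * A i) ^ 2 ^ k).trace := by
  have h := norm_trace_list_prod_pow_le k (List.ofFn A) (List.length_ofFn)
  rwa [List.map_ofFn, List.prod_ofFn] at h

/-- **Dyadic trace Hölder inequality for positive matrices**: if every `A_i` is positive
semidefinite then `A_iᴴ A_i = A_i²` and `‖Tr(A₀ A₁ ⋯ A_{M-1})‖^M ≤ ∏_i Re Tr A_i^M`, `M = 2^{k+1}`,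
i.e. `|Tr ∏ A_i| ≤ ∏ (Tr A_i^M)^{1/M}`. Simon, *Trace Ideals* (2005), Thm. 2.8.
[cite: Simon2005TraceIdeals, Theorem 2.8] -/
theorem norm_trace_ofFn_prod_pow_le_of_posSemidef (k : ℕ) (A : Fin (2 ^ (k + 1)) → Matrix n n 𝕜)
    (hA : ∀ i, (A i).PosSemidef) :
    ‖(List.ofFn A).prod.trace‖ ^ 2 ^ (k + 1) ≤ ∏ i, RCLike.re ((A i) ^ 2 ^ (k + 1)).trace := by
  have h := norm_trace_ofFn_prod_pow_le k A
  have hsq : ∀ i, ((A i)ᴴ * A i) ^ 2 ^ k = (A i) ^ 2 ^ (k + 1) := by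
    intro i
    rw [(hA i).1.eq, ← pow_two, ← pow_mul, ← pow_succ']
  simpa only [hsq] using h

/-! ### Exponential (thermal) form -/

/-- **Trace Hölder for products of exponentials of Hermitian matrices** (dyadic number of factors
`M = 2^{k+1}`): `‖Tr ∏_i e^{G_i}‖^M ≤ ∏_i Re Tr e^{M • G_i}` for Hermitian complex `G_i`
(`e^{G_i} ≥ 0` and `(e^{G_i})^M = e^{M • G_i}`). With `G_τ = -a H_τ` this is the inequality
`|Tr ∏_τ e^{-a H_τ}| ≤ ∏_τ (Tr e^{-M a H_τ})^{1/M}` of the route's coercivity dictionary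
(docstring of `BirBdGPhaseCoercivity`, ROLE). Simon, *Trace Ideals* (2005), Thm. 2.8.
[cite: Simon2005TraceIdeals, Theorem 2.8] -/
theorem norm_trace_prod_exp_pow_le {m : Type*} [Fintype m] [DecidableEq m] (k : ℕ)
    (G : Fin (2 ^ (k + 1)) → Matrix m m ℂ) (hG : ∀ i, (G i).IsHermitian) :
    ‖(List.ofFn fun i => exp (G i)).prod.trace‖ ^ 2 ^ (k + 1) ≤
      ∏ i, ((exp ((2 ^ (k + 1)) • G i)).trace).re := by
  have h := norm_trace_ofFn_prod_pow_le_of_posSemidef k (fun i => exp (G i))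
    (fun i => posSemidef_exp_of_isHermitian (hG i))
  simpa only [Matrix.exp_nsmul, RCLike.re_to_complex] using h

/-- **Thermal form** of the dyadic trace Hölder inequality: for Hermitian `H_τ`, `τ < M = 2^{k+1}`,
and a real `a`, `‖Tr ∏_τ e^{-a H_τ}‖ ≤ ∏_τ (Re Tr e^{-(M a) H_τ})^{1/M}` — the modulus of an
`M`-slice Trotter weight is bounded by the geometric mean of the slice partition functions at
inverse temperature `β = M a`. Simon, *Trace Ideals* (2005), Thm. 2.8.
[cite: Simon2005TraceIdeals, Theorem 2.8] -/
theorem norm_trace_prod_exp_neg_smul_le {m : Type*} [Fintype m] [DecidableEq m] (k : ℕ) (a : ℝ)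
    (H : Fin (2 ^ (k + 1)) → Matrix m m ℂ) (hH : ∀ i, (H i).IsHermitian) :
    ‖(List.ofFn fun i => exp (-(a : ℂ) • H i)).prod.trace‖ ≤
      ∏ i, ((exp (-((((2 ^ (k + 1) : ℕ) : ℝ) * a : ℝ) : ℂ) • H i)).trace).re ^
        (1 / ((2 ^ (k + 1) : ℕ) : ℝ)) := by
  have hG : ∀ i, (-(a : ℂ) • H i).IsHermitian := by
    intro i
    have h := isHermitian_real_smul (hH i) (-a)
    rwa [Complex.ofReal_neg] at h
  have h := norm_trace_prod_exp_pow_le k (fun i => -(a : ℂ) • H i) hG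
  have hsmul : ∀ i, (2 ^ (k + 1)) • (-(a : ℂ) • H i) =
      (-((((2 ^ (k + 1) : ℕ) : ℝ) * a : ℝ) : ℂ)) • H i := by
    intro i
    rw [← Nat.cast_smul_eq_nsmul ℂ, smul_smul]
    congr 1
    push_cast
    ring
  simp only [hsmul] at h
  -- nonnegativity of the slice partition functions `Re Tr e^{-β H_i}`
  have hZ : ∀ i, 0 ≤ ((exp (-((((2 ^ (k + 1) : ℕ) : ℝ) * a : ℝ) : ℂ) • H i)).trace).re := by
    intro i
    have hh : (-((((2 ^ (k + 1) : ℕ) : ℝ) * a : ℝ) : ℂ) • H i).IsHermitian := by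
      have h' := isHermitian_real_smul (hH i) (-((((2 ^ (k + 1) : ℕ) : ℝ) * a : ℝ)))
      rwa [Complex.ofReal_neg] at h'
    have := re_trace_nonneg_of_posSemidef (posSemidef_exp_of_isHermitian hh)
    simpa only [RCLike.re_to_complex] using this
  have hM : ((2 ^ (k + 1) : ℕ) : ℝ) ≠ 0 := by positivity
  have hroot : ‖(List.ofFn fun i => exp (-(a : ℂ) • H i)).prod.trace‖ =
      (‖(List.ofFn fun i => exp (-(a : ℂ) • H i)).prod.trace‖ ^ (2 ^ (k + 1))) ^
        (1 / ((2 ^ (k + 1) : ℕ) : ℝ)) := by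
    rw [one_div, Nat.cast_pow, Nat.cast_ofNat, ← Nat.cast_ofNat (R := ℝ), ← Nat.cast_pow,
      Real.pow_rpow_inv_natCast (norm_nonneg _) (pow_ne_zero _ two_ne_zero)]
  rw [hroot, Real.finsetProd_rpow _ _ (fun i _ => hZ i)]
  exact Real.rpow_le_rpow (pow_nonneg (norm_nonneg _) _) h (by positivity)

/-! ### The coercivity dictionary: Hölder + per-slice free-energy bounds -/

/-- **Hölder with per-slice free-energy bounds.** If each slice partition function at inverse
temperature `M` (in units of the slice Hamiltonians `-G_i`) obeys `Re Tr e^{M • G_i} ≤ e^{M b_i}`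
for reals `b_i`, then the `M`-slice weight is bounded by `‖Tr ∏_i e^{G_i}‖ ≤ e^{Σ_i b_i}`
(`M = 2^{k+1}`): the geometric mean of the bounds. For quasi-free (BdG) slices,
`b_i = (a/2) Σ_j |λ_j(θ_i)| + (log 4^{|Λ|})/M` is the free-energy bound of the slice with phase
configuration `θ_i`. Simon, *Trace Ideals* (2005), Thm. 2.8 (Hölder); the use is the route's
coercivity dictionary (docstring of `BirBdGPhaseCoercivity`, ROLE). [cite: Simon2005TraceIdeals, Theorem 2.8] -/
theorem norm_trace_prod_exp_le_exp_sum {m : Type*} [Fintype m] [DecidableEq m] (k : ℕ)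
    (G : Fin (2 ^ (k + 1)) → Matrix m m ℂ) (hG : ∀ i, (G i).IsHermitian) (b : Fin (2 ^ (k + 1)) → ℝ)
    (hb : ∀ i, ((exp ((2 ^ (k + 1)) • G i)).trace).re ≤ Real.exp (2 ^ (k + 1) * b i)) :
    ‖(List.ofFn fun i => exp (G i)).prod.trace‖ ≤ Real.exp (∑ i, b i) := by
  have h := norm_trace_prod_exp_pow_le k G hG
  have hZ : ∀ i, 0 ≤ ((exp ((2 ^ (k + 1)) • G i)).trace).re := by
    intro i
    have hh : ((2 ^ (k + 1)) • G i).IsHermitian := by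
      rw [← Nat.cast_smul_eq_nsmul ℂ, ← Complex.ofReal_natCast]
      exact isHermitian_real_smul (hG i) _
    have := re_trace_nonneg_of_posSemidef (posSemidef_exp_of_isHermitian hh)
    simpa only [RCLike.re_to_complex] using this
  have h2 : ‖(List.ofFn fun i => exp (G i)).prod.trace‖ ^ 2 ^ (k + 1) ≤
      Real.exp (∑ i, b i) ^ 2 ^ (k + 1) := by
    calc ‖(List.ofFn fun i => exp (G i)).prod.trace‖ ^ 2 ^ (k + 1)
        ≤ ∏ i, ((exp ((2 ^ (k + 1)) • G i)).trace).re := h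
      _ ≤ ∏ i, Real.exp (2 ^ (k + 1) * b i) :=
          Finset.prod_le_prod (fun i _ => hZ i) (fun i _ => hb i)
      _ = Real.exp (∑ i, b i) ^ 2 ^ (k + 1) := by
          rw [← Real.exp_sum, ← Finset.mul_sum, ← Real.exp_nat_mul]
          push_cast
          ring_nf
  exact le_of_pow_le_pow_left₀ (pow_ne_zero _ two_ne_zero) (Real.exp_nonneg _) h2

/-- **The coercivity dictionary (shape).** If, in addition, the per-slice free-energy exponents
obey a rigidity bound `b_i ≤ b₀ - κ R_i` (for quasi-free BdG slices this is crux 3,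
`BirBdGPhaseCoercivity`: `Σ_j |λ_j(θ)| ≤ Σ_j |λ_j(0)| - c₀ R(θ)`, with `κ = a c₀ / 2` and `R` the
nearest-neighbour misalignment functional), then the modulus of the `M`-slice weight carries one
small factor per misaligned slice: `‖Tr ∏_i e^{G_i}‖ ≤ e^{M b₀} · e^{-κ Σ_i R_i}`, `M = 2^{k+1}`.
Simon, *Trace Ideals* (2005), Thm. 2.8 (Hölder) + arithmetic. [cite: Simon2005TraceIdeals, Theorem 2.8] -/
theorem norm_trace_prod_exp_le_exp_sub_sum {m : Type*} [Fintype m] [DecidableEq m] (k : ℕ)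
    (G : Fin (2 ^ (k + 1)) → Matrix m m ℂ) (hG : ∀ i, (G i).IsHermitian) (b : Fin (2 ^ (k + 1)) → ℝ)
    (hb : ∀ i, ((exp ((2 ^ (k + 1)) • G i)).trace).re ≤ Real.exp (2 ^ (k + 1) * b i))
    (b₀ κ : ℝ) (R : Fin (2 ^ (k + 1)) → ℝ) (hR : ∀ i, b i ≤ b₀ - κ * R i) :
    ‖(List.ofFn fun i => exp (G i)).prod.trace‖ ≤
      Real.exp (2 ^ (k + 1) * b₀) * Real.exp (-(κ * ∑ i, R i)) := by
  refine (norm_trace_prod_exp_le_exp_sum k G hG b hb).trans ?_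
  rw [← Real.exp_add, Real.exp_le_exp, Finset.mul_sum, ← sub_eq_add_neg]
  calc ∑ i, b i ≤ ∑ i, (b₀ - κ * R i) := Finset.sum_le_sum fun i _ => hR i
    _ = 2 ^ (k + 1) * b₀ - ∑ i, κ * R i := by
        rw [Finset.sum_sub_distrib, Finset.sum_const, Finset.card_univ, Fintype.card_fin]
        simp

end Summit.HubbardSuperconductivity.HubbardSuperconductivity.Theorems
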